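import Summits.Langlands.Langlands.Theorems.SkinnerWilesDefectOneEisensteinProModularSeedRestrictTwistGaloisPackageAux3

/-!
# Stub `stub_restrictTwistGaloisPackage` of the line `descend-raise-basechange`
# (crux `Summit.Langlands.Langlands.Theses.SkinnerWilesDefectOne.EisensteinProModularSeed`, stmt-Langlands-12920)

**S3 — the Galois-side transport.** `F` imaginary quadratic, `p` any prime, `O = 𝒪_{ℚ̄_p}`;
`(ρ, ρ₀)` a continuous `Γ_F → GL₂(ℚ̄_p)` with residually upper-triangular integral model, unramified
almost everywhere, `p`-distinguished at every `v ∣ p`; `(η, M, k, ρ', ρ'₀)` the `ℚ`-side package of S2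
(unit-valued continuous `η` with the DESCENT relation `η̄(σ|_ℚ) χ̄_a(σ) = χ̄_b(σ)`, `M` prime inert in
`F`, `k ≥ 2`, `ρ'` irreducible with integral model of ordered residual diagonal `(1, η̄)`, the oriented
ordinary clause over `ℚ_p` with `m = 1`, and the level clause `(lev)`).  THEN with

* `ν :=` the Teichmüller lift of `χ̄_a` (`RestrictTwist.exists_teichmuller_character`: continuous, of
  finite exponent `n`, `≡ χ̄_a`, trivial where `χ̄_a` is),
* `r := ν ⊗ ρ'|_{Γ_F}` (`FramedRep.twist (ρ'.restrictField F) ν`, `(r σ) = ν(σ) • ρ'(σ|_ℚ)`),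
  `r₀ := ν₀ · ρ'₀|_{Γ_F}` (`RestrictTwist.exists_integral_twist`),
* `q := M𝓞_F`, `S := {v ∣ p} ∪ {q} ∪ {v : χ̄_a or χ̄_b ramified at v}`,

`r` is irreducible (`RestrictTwist.isIrreducible_twist_restrict`, Clifford), `r₀` is an integral model of
`r` with the same ordered residual diagonal as `ρ₀`, `r` is oriented-ordinary of parallel weight `k` with
exponent `n` at every `v ∣ p` (`RestrictTwist.orientedOrdinary_twist_restrict`), `S` is finite
(`{χ̄ ramified} ⊆ {ρ ramified}`), contains the places above `p`, `r` is unramified outside `S`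
(`RestrictTwist.isUnramifiedAt_twist_restrict`), and the level clause holds for `S` by definition.
The registered signature is restated verbatim (fully qualified).

References: C. Skinner, A. Wiles, *Residually reducible representations and modular forms*, Publ. Math.
IHÉS 89 (1999), §1; K. Ribet, Invent. Math. 34 (1976), §2; J.-P. Serre, *Abelian ℓ-adic
representations* (1968), Ch. I §2.1; Curtis–Reiner, *Methods of Representation Theory* I, §11. [folklore]
-/

set_option linter.dupNamespace false -- project-wide option (lakefile weak.linter.dupNamespace); `Summit.Langlands.Langlands` is the mandated namespace

noncomputable section

namespace Summit.Langlands.Langlands.Theorems.SkinnerWilesDefectOne.EisensteinProModularSeed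

open Literature.NumberTheory.GaloisRepresentations
open Summit.Langlands.Langlands.Theorems.EisensteinProModularSeed.Negative
  (mem_maximalIdeal_of_v_lt_one entry_eq_of_integralModel sub_mem_maximalIdeal_iff)
open Summit.Langlands.Langlands.Theorems.SkinnerWilesDefectOne.EisensteinProModularSeed.RestrictTwist
open IsLocalRing Field IsDedekindDomain NumberField Filter
open scoped NumberField Matrix

/-- **stub_restrictTwistGaloisPackage** (line `descend-raise-basechange`, S3 — Galois-side transport:
restrict to `Γ_F`, twist by the Teichmüller lift of `χ̄_a`, Clifford irreducibility, oriented frames at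
`v ∣ p`, level set `S`; statement = the registered stub of
`Cruxes/EisensteinProModularSeed/Lines/descend-raise-basechange.lean`: the text of its readable form
`S.stub_restrictTwistGaloisPackage`, verbatim, with the skeleton's `open`s — it elaborates to the registered
fully-qualified signature, see `stub_restrictTwistGaloisPackage_fq` below). See the module docstring for the
construction and `RestrictTwist.*` for the four assembly steps.
Skinner–Wiles (1999) §1; Serre (1968) Ch. I §2.1; Curtis–Reiner I §11. [folklore] -/
theorem stub_restrictTwistGaloisPackage :
    ∀ (F : Type) [Field F] [NumberField F], IsTotallyComplex F → Module.finrank ℚ F = 2 → ∀ (p : ℕ) [Fact p.Prime] (O : ValuationSubring (PadicAlgCl p)), O = (Valued.v : Valuation (PadicAlgCl p) NNReal).valuationSubring → ∀ (ρ : FramedGaloisRep F (PadicAlgCl p) 2) (ρ₀ : absoluteGaloisGroup F →* Matrix.GeneralLinearGroup (Fin 2) O), (∀ᶠ v in cofinite, ρ.IsUnramifiedAt v) → ρ.HasUpperTriangularIntegralModel ρ₀ → (∀ v : HeightOneSpectrum (𝓞 F), (p : 𝓞 F) ∈ v.asIdeal → IsPDistinguishedAt ρ₀ v) → ∀ (η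 : absoluteGaloisGroup ℚ →ₜ* (PadicAlgCl p)ˣ) (M k : ℕ) (ρ' : FramedGaloisRep ℚ (PadicAlgCl p) 2) (ρ'₀ : absoluteGaloisGroup ℚ →* Matrix.GeneralLinearGroup (Fin 2) O), (∀ τ, Valued.v ((η τ : (PadicAlgCl p)ˣ) : PadicAlgCl p) = 1) → (∀ σ : absoluteGaloisGroup F, Valued.v (((η (absGaloisRestrict ℚ F σ) : (PadicAlgCl p)ˣ) : PadicAlgCl p) * ((ρ₀ σ).val 0 0 : PadicAlgCl p) - ((ρ₀ σ).val 1 1 : PadicAlgCl p)) < 1) → M.Prime → (Ideal.span {(M : 𝓞 F)}).IsPrime → 2 ≤ k → ρ'.toGaloisRep.IsIrreducible → ρ'.HasUpperTriangularIntegralModel ρ'₀ → (∀ g, ((ρ'₀ g).val 0 0 - 1 : O) ∈ maximalIdeal O ∧ Valued.v (((ρ'₀ g).val 1 1 : PadicAlgCl p) - ((η g : (PadicAlgCl p)ˣ) : PadicAlgCl p)) < 1) → (∀ w : HeightOneSpectrum (𝓞 ℚ), (p : 𝓞 ℚ) ∈ w.asIdeal → ∃ Q : Matrix.GeneralLinearGroup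 (Fin 2) (PadicAlgCl p), Valued.v (Q.val 0 0) ≤ Valued.v (Q.val 1 0) ∧ ∀ σ, (Q⁻¹ * ρ'.toLocal w σ * Q).val 1 0 = 0 ∧ (σ ∈ absInertia (w.adicCompletion ℚ) → (Q⁻¹ * ρ'.toLocal w σ * Q).val 1 1 = 1 ∧ (Q⁻¹ * ρ'.toLocal w σ * Q).val 0 0 = algebraMap (Padic p) (PadicAlgCl p) (((GaloisRep.cyclotomicCharacter (w.adicCompletion ℚ) p σ).val : PadicInt p) : Padic p) ^ (k - 1))) → (∀ w : HeightOneSpectrum (𝓞 ℚ), (M : 𝓞 ℚ) ∉ w.asIdeal → (p : 𝓞 ℚ) ∉ w.asIdeal → ∀ 𝔓 ∈ w.primesAbove, ∀ σ ∈ 𝔓.inertia (absoluteGaloisGroup ℚ), Valued.v (((η σ : (PadicAlgCl p)ˣ) : PadicAlgCl p) - 1) < 1 → ρ' σ = 1) → ∃ (r : FramedGaloisRep F (PadicAlgCl p) 2) (r₀ : absoluteGaloisGroup F →* Matrix.GeneralLinearGroup (Fin 2) O) (ν : absoluteGaloisGroup F →ₜ* (PadicAlgCl p)ˣ) (q : HeightOneSpectrum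 (𝓞 F)) (S : Set (HeightOneSpectrum (𝓞 F))), (∃ n : ℕ, 0 < n ∧ ∀ σ, ν σ ^ n = 1) ∧ (∀ σ, (r σ).val = ((ν σ : (PadicAlgCl p)ˣ) : PadicAlgCl p) • (ρ' (absGaloisRestrict ℚ F σ)).val) ∧ r.toGaloisRep.IsIrreducible ∧ r.HasUpperTriangularIntegralModel r₀ ∧ (∀ g, ((r₀ g).val 0 0 - (ρ₀ g).val 0 0 : O) ∈ maximalIdeal O ∧ ((r₀ g).val 1 1 - (ρ₀ g).val 1 1 : O) ∈ maximalIdeal O) ∧ (∃ k' : ℕ, 2 ≤ k' ∧ ∃ m : ℕ, 0 < m ∧ ∀ v : HeightOneSpectrum (𝓞 F), (p : 𝓞 F) ∈ v.asIdeal → ∃ Q : Matrix.GeneralLinearGroup (Fin 2) (PadicAlgCl p), Valued.v (Q.val 0 0) ≤ Valued.v (Q.val 1 0) ∧ ∀ σ, (Q⁻¹ * r.toLocal v σ * Q).val 1 0 = 0 ∧ (σ ∈ absInertia (v.adicCompletion F) → (Q⁻¹ * r.toLocal v σ * Q).val 1 1 ^ m = 1 ∧ (Q⁻¹ * r.toLocal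 v σ * Q).val 0 0 ^ m = algebraMap (Padic p) (PadicAlgCl p) (((GaloisRep.cyclotomicCharacter (v.adicCompletion F) p σ).val : PadicInt p) : Padic p) ^ ((k' - 1) * m))) ∧ S.Finite ∧ (∀ v : HeightOneSpectrum (𝓞 F), (p : 𝓞 F) ∈ v.asIdeal → v ∈ S) ∧ (∀ v ∉ S, r.IsUnramifiedAt v) ∧ (∀ v : HeightOneSpectrum (𝓞 F), v ≠ q → (p : 𝓞 F) ∉ v.asIdeal → (∀ 𝔓 ∈ v.primesAbove, ∀ σ ∈ 𝔓.inertia (absoluteGaloisGroup F), ((ρ₀ σ).val 0 0 - 1 : O) ∈ maximalIdeal O ∧ ((ρ₀ σ).val 1 1 - 1 : O) ∈ maximalIdeal O) → v ∉ S) := by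
  intro F _ _ _ hF2 p _ O hO ρ ρ₀ hunr hmod hdist η M k ρ' ρ'₀ hη hdesc hM hMF hk hirr hmod' hdiag
    hord hlev
  classical
  -- the Teichmüller character `ν` and the twist `r = ν ⊗ ρ'|_{Γ_F}` with its integral model `r₀`
  obtain ⟨ν₀, ν, n, hn, hν₀n, hνν₀, hν₀res, hν₀1⟩ := exists_teichmuller_character hO hmod
  obtain ⟨r₀, hr₀⟩ := exists_integral_twist (ρ'₀.comp (absGaloisRestrict ℚ F).toMonoidHom) ν₀
  set r : FramedGaloisRep F (PadicAlgCl p) 2 := FramedRep.twist (ρ'.restrictField F) ν with hr_def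
  have hr : ∀ σ, r σ = FramedRep.scalar (PadicAlgCl p) 2 (ν σ) * ρ' (absGaloisRestrict ℚ F σ) :=
    fun σ => rfl
  have hνn : ∀ σ, ν σ ^ n = 1 := fun σ => by rw [hνν₀, ← map_pow, hν₀n, map_one]
  have hν1 : ∀ σ, ((ρ₀ σ).val 0 0 - 1 : O) ∈ maximalIdeal O → ν σ = 1 := fun σ hσ => by
    rw [hνν₀, hν₀1 σ hσ, map_one]
  have hr₀' : ∀ g (i j : Fin 2), (r₀ g).val i j =
      (ν₀ g : O) * (ρ'₀ (absGaloisRestrict ℚ F g)).val i j := fun g i j => by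
    rw [hr₀ g, scalar_mul_val_apply]; rfl
  -- `r₀` is a residually upper-triangular integral model of `r`, with the diagonal of `ρ₀`
  have hmodr : r.HasUpperTriangularIntegralModel r₀ := by
    refine ⟨fun g => Units.ext (Matrix.ext fun i j => ?_),
      (isResiduallyUpperTriangular_two_iff r₀).mpr fun g => ?_⟩
    · change O.subtype ((r₀ g).val i j) = (r g).val i j
      rw [hr, hr₀', scalar_mul_val_apply, map_mul, hνν₀, Units.coe_map,
        entry_eq_of_integralModel hmod' _ i j]
      rfl
    · rw [hr₀']
      exact Ideal.mul_mem_left _ _ ((isResiduallyUpperTriangular_two_iff _).mp hmod'.2 _)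
  have hdiagr : ∀ g, ((r₀ g).val 0 0 - (ρ₀ g).val 0 0 : O) ∈ maximalIdeal O ∧
      ((r₀ g).val 1 1 - (ρ₀ g).val 1 1 : O) ∈ maximalIdeal O := by
    intro g
    obtain ⟨ha, hd⟩ := hdiag (absGaloisRestrict ℚ F g)
    have hηO : ((η (absGaloisRestrict ℚ F g) : (PadicAlgCl p)ˣ) : PadicAlgCl p) ∈ O := by
      rw [hO, Valuation.mem_valuationSubring_iff]; exact (hη _).le
    have hd' : (ρ'₀ (absGaloisRestrict ℚ F g)).val 1 1 - ⟨_, hηO⟩ ∈ maximalIdeal O :=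
      mem_maximalIdeal_of_v_lt_one hO (by push_cast; exact hd)
    have hdesc' : (ρ₀ g).val 0 0 * ⟨_, hηO⟩ - (ρ₀ g).val 1 1 ∈ maximalIdeal O :=
      mem_maximalIdeal_of_v_lt_one hO (by push_cast; rw [mul_comm]; exact hdesc g)
    rw [sub_mem_maximalIdeal_iff] at ha hd' hdesc'
    rw [sub_mem_maximalIdeal_iff, sub_mem_maximalIdeal_iff, hr₀', hr₀', map_mul, map_mul, hν₀res,
      ha, hd', map_one, mul_one, ← map_mul, hdesc']
    exact ⟨rfl, rfl⟩
  -- the auxiliary place `q = M𝓞_F` and the level set `S`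
  have hM0 : Ideal.span {(M : 𝓞 F)} ≠ ⊥ := by
    rw [Ne, Ideal.span_singleton_eq_bot]; exact Nat.cast_ne_zero.mpr hM.ne_zero
  set q : HeightOneSpectrum (𝓞 F) := ⟨Ideal.span {(M : 𝓞 F)}, hMF, hM0⟩ with hq
  set S : Set (HeightOneSpectrum (𝓞 F)) :=
    {v | (p : 𝓞 F) ∈ v.asIdeal} ∪ {q} ∪
      {v | ¬ ∀ 𝔓 ∈ v.primesAbove, ∀ σ ∈ 𝔓.inertia (absoluteGaloisGroup F),
        ((ρ₀ σ).val 0 0 - 1 : O) ∈ maximalIdeal O ∧ ((ρ₀ σ).val 1 1 - 1 : O) ∈ maximalIdeal O}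
    with hS
  refine ⟨r, r₀, ν, q, S, ⟨n, hn, hνn⟩, fun σ => FramedRep.coe_twist_apply _ _ σ,
    isIrreducible_twist_restrict hF2 hO hdist η hη hdesc hirr hmod' hdiag ν r hr, hmodr, hdiagr,
    ⟨k, hk, n, hn, fun v hv => orientedOrdinary_twist_restrict hO η hη hmod' hdiag hord ν hνn r hr v hv⟩,
    ?_, fun v hv => Set.mem_union_left _ (Set.mem_union_left _ hv), fun v hvS => ?_,
    fun v hvq hpv hres hvS => ?_⟩
  · -- `S` is finite: `{χ̄ ramified} ⊆ {ρ ramified}`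
    have h1 : {v : HeightOneSpectrum (𝓞 F) | (p : 𝓞 F) ∈ v.asIdeal}.Finite := by
      have hp0 : Ideal.span {(p : 𝓞 F)} ≠ 0 := by
        rw [Ne, Submodule.zero_eq_bot, Ideal.span_singleton_eq_bot]
        exact Nat.cast_ne_zero.mpr (Fact.out : p.Prime).ne_zero
      exact (Ideal.finite_factors hp0).subset fun v hv => Ideal.dvd_span_singleton.mpr hv
    have h3 : {v : HeightOneSpectrum (𝓞 F) | ¬ ∀ 𝔓 ∈ v.primesAbove,
        ∀ σ ∈ 𝔓.inertia (absoluteGaloisGroup F), ((ρ₀ σ).val 0 0 - 1 : O) ∈ maximalIdeal O ∧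
          ((ρ₀ σ).val 1 1 - 1 : O) ∈ maximalIdeal O}.Finite := by
      refine (Filter.eventually_cofinite.mp hunr).subset fun v hv hunrv => hv fun 𝔓 h𝔓 σ hσ => ?_
      have e : ∀ i, (ρ₀ σ).val i i = 1 := fun i => by
        apply Subtype.ext
        rw [← entry_eq_of_integralModel hmod σ i i, hunrv 𝔓 h𝔓 σ hσ]
        simp
      rw [e 0, e 1, sub_self]
      exact ⟨zero_mem _, zero_mem _⟩
    exact (h1.union (Set.finite_singleton q)).union h3
  · -- `r` is unramified outside `S`
    have hpv : (p : 𝓞 F) ∉ v.asIdeal := fun h => hvS (Set.mem_union_left _ (Set.mem_union_left _ h))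
    have hvq : v ≠ q := fun h => hvS (Set.mem_union_left _ (Set.mem_union_right _ h))
    have hres : ∀ 𝔓 ∈ v.primesAbove, ∀ σ ∈ 𝔓.inertia (absoluteGaloisGroup F),
        ((ρ₀ σ).val 0 0 - 1 : O) ∈ maximalIdeal O ∧ ((ρ₀ σ).val 1 1 - 1 : O) ∈ maximalIdeal O := by
      by_contra h
      exact hvS (Set.mem_union_right _ h)
    have hMv : (M : 𝓞 F) ∉ v.asIdeal := fun hMv => hvq (by
      have hle : Ideal.span {(M : 𝓞 F)} ≤ v.asIdeal := (Ideal.span_singleton_le_iff_mem _).mpr hMv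
      exact HeightOneSpectrum.ext ((hMF.isMaximal hM0).eq_of_le v.isPrime.ne_top hle).symm)
    exact isUnramifiedAt_twist_restrict hO η hη hdesc hlev ν hν1 r hr hpv hMv hres
  · -- the level clause
    rcases hvS with (hv | hv) | hv
    · exact hpv hv
    · exact hvq hv
    · exact hv hres

/-- The registered stub in its FULLY QUALIFIED spelling (lines 538–594 of the line skeleton, verbatim):
definitionally the statement of `stub_restrictTwistGaloisPackage` (the proof is that term). [folklore] -/
theorem stub_restrictTwistGaloisPackage_fq :
    ∀ (F : Type) [Field F] [NumberField F], NumberField.IsTotallyComplex F → Module.finrank ℚ F = 2 →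
      ∀ (p : ℕ) [Fact p.Prime] (O : ValuationSubring (PadicAlgCl p)),
      O = (Valued.v : Valuation (PadicAlgCl p) NNReal).valuationSubring →
      ∀ (ρ : Literature.NumberTheory.GaloisRepresentations.FramedGaloisRep F (PadicAlgCl p) 2)
        (ρ₀ : Field.absoluteGaloisGroup F →* Matrix.GeneralLinearGroup (Fin 2) O),
      (∀ᶠ v in Filter.cofinite, ρ.IsUnramifiedAt v) → ρ.HasUpperTriangularIntegralModel ρ₀ →
      (∀ v : IsDedekindDomain.HeightOneSpectrum (NumberField.RingOfIntegers F), (p : NumberField.RingOfIntegers F) ∈ v.asIdeal → Literature.NumberTheory.GaloisRepresentations.IsPDistinguishedAt ρ₀ v) →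
      ∀ (η : Field.absoluteGaloisGroup ℚ →ₜ* (PadicAlgCl p)ˣ) (M k : ℕ)
        (ρ' : Literature.NumberTheory.GaloisRepresentations.FramedGaloisRep ℚ (PadicAlgCl p) 2)
        (ρ'₀ : Field.absoluteGaloisGroup ℚ →* Matrix.GeneralLinearGroup (Fin 2) O),
      (∀ τ, Valued.v ((η τ : (PadicAlgCl p)ˣ) : PadicAlgCl p) = 1) →
      (∀ σ : Field.absoluteGaloisGroup F,
        Valued.v (((η (Literature.NumberTheory.GaloisRepresentations.absGaloisRestrict ℚ F σ) : (PadicAlgCl p)ˣ) : PadicAlgCl p) *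
            ((ρ₀ σ).val 0 0 : PadicAlgCl p) - ((ρ₀ σ).val 1 1 : PadicAlgCl p)) < 1) →
      M.Prime → (Ideal.span {(M : NumberField.RingOfIntegers F)}).IsPrime → 2 ≤ k →
      ρ'.toGaloisRep.IsIrreducible → ρ'.HasUpperTriangularIntegralModel ρ'₀ →
      (∀ g, ((ρ'₀ g).val 0 0 - 1 : O) ∈ IsLocalRing.maximalIdeal O ∧
        Valued.v (((ρ'₀ g).val 1 1 : PadicAlgCl p) - ((η g : (PadicAlgCl p)ˣ) : PadicAlgCl p)) < 1) →
      (∀ w : IsDedekindDomain.HeightOneSpectrum (NumberField.RingOfIntegers ℚ), (p : NumberField.RingOfIntegers ℚ) ∈ w.asIdeal →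
        ∃ Q : Matrix.GeneralLinearGroup (Fin 2) (PadicAlgCl p),
          Valued.v (Q.val 0 0) ≤ Valued.v (Q.val 1 0) ∧
          ∀ σ, (Q⁻¹ * ρ'.toLocal w σ * Q).val 1 0 = 0 ∧
            (σ ∈ Literature.NumberTheory.GaloisRepresentations.absInertia (w.adicCompletion ℚ) →
              (Q⁻¹ * ρ'.toLocal w σ * Q).val 1 1 = 1 ∧
              (Q⁻¹ * ρ'.toLocal w σ * Q).val 0 0 =
                algebraMap (Padic p) (PadicAlgCl p)
                  (((Literature.NumberTheory.GaloisRepresentations.GaloisRep.cyclotomicCharacter (w.adicCompletion ℚ) p σ).val : PadicInt p) :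
                    Padic p) ^ (k - 1))) →
      (∀ w : IsDedekindDomain.HeightOneSpectrum (NumberField.RingOfIntegers ℚ), (M : NumberField.RingOfIntegers ℚ) ∉ w.asIdeal → (p : NumberField.RingOfIntegers ℚ) ∉ w.asIdeal →
        ∀ 𝔓 ∈ w.primesAbove, ∀ σ ∈ 𝔓.inertia (Field.absoluteGaloisGroup ℚ),
          Valued.v (((η σ : (PadicAlgCl p)ˣ) : PadicAlgCl p) - 1) < 1 → ρ' σ = 1) →
      ∃ (r : Literature.NumberTheory.GaloisRepresentations.FramedGaloisRep F (PadicAlgCl p) 2)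
        (r₀ : Field.absoluteGaloisGroup F →* Matrix.GeneralLinearGroup (Fin 2) O)
        (ν : Field.absoluteGaloisGroup F →ₜ* (PadicAlgCl p)ˣ) (q : IsDedekindDomain.HeightOneSpectrum (NumberField.RingOfIntegers F))
        (S : Set (IsDedekindDomain.HeightOneSpectrum (NumberField.RingOfIntegers F))),
        (∃ n : ℕ, 0 < n ∧ ∀ σ, ν σ ^ n = 1) ∧
        (∀ σ, (r σ).val = ((ν σ : (PadicAlgCl p)ˣ) : PadicAlgCl p) • (ρ' (Literature.NumberTheory.GaloisRepresentations.absGaloisRestrict ℚ F σ)).val) ∧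
        r.toGaloisRep.IsIrreducible ∧ r.HasUpperTriangularIntegralModel r₀ ∧
        (∀ g, ((r₀ g).val 0 0 - (ρ₀ g).val 0 0 : O) ∈ IsLocalRing.maximalIdeal O ∧
          ((r₀ g).val 1 1 - (ρ₀ g).val 1 1 : O) ∈ IsLocalRing.maximalIdeal O) ∧
        (∃ k' : ℕ, 2 ≤ k' ∧ ∃ m : ℕ, 0 < m ∧ ∀ v : IsDedekindDomain.HeightOneSpectrum (NumberField.RingOfIntegers F), (p : NumberField.RingOfIntegers F) ∈ v.asIdeal →
          ∃ Q : Matrix.GeneralLinearGroup (Fin 2) (PadicAlgCl p),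
            Valued.v (Q.val 0 0) ≤ Valued.v (Q.val 1 0) ∧
            ∀ σ, (Q⁻¹ * r.toLocal v σ * Q).val 1 0 = 0 ∧
              (σ ∈ Literature.NumberTheory.GaloisRepresentations.absInertia (v.adicCompletion F) →
                (Q⁻¹ * r.toLocal v σ * Q).val 1 1 ^ m = 1 ∧
                (Q⁻¹ * r.toLocal v σ * Q).val 0 0 ^ m =
                  algebraMap (Padic p) (PadicAlgCl p)
                    (((Literature.NumberTheory.GaloisRepresentations.GaloisRep.cyclotomicCharacter (v.adicCompletion F) p σ).val : PadicInt p) :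
                      Padic p) ^ ((k' - 1) * m))) ∧
        S.Finite ∧ (∀ v : IsDedekindDomain.HeightOneSpectrum (NumberField.RingOfIntegers F), (p : NumberField.RingOfIntegers F) ∈ v.asIdeal → v ∈ S) ∧
        (∀ v ∉ S, r.IsUnramifiedAt v) ∧
        (∀ v : IsDedekindDomain.HeightOneSpectrum (NumberField.RingOfIntegers F), v ≠ q → (p : NumberField.RingOfIntegers F) ∉ v.asIdeal →
          (∀ 𝔓 ∈ v.primesAbove, ∀ σ ∈ 𝔓.inertia (Field.absoluteGaloisGroup F),
            ((ρ₀ σ).val 0 0 - 1 : O) ∈ IsLocalRing.maximalIdeal O ∧ ((ρ₀ σ).val 1 1 - 1 : O) ∈ IsLocalRing.maximalIdeal O) →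
          v ∉ S) :=
  stub_restrictTwistGaloisPackage

end Summit.Langlands.Langlands.Theorems.SkinnerWilesDefectOne.EisensteinProModularSeed

end
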